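import Summits.QuantumFields.YangMills.Theorems.BalabanLadderIRPinnedExit96
import Summits.QuantumFields.YangMills.Theorems.BalabanLadderIRColdPressurePincer
import Summits.QuantumFields.YangMills.Theorems.BalabanLadderIRTwistCostOfPurity
import Summits.QuantumFields.YangMills.Theorems.BalabanLadderIRColdPurityDobrushinCorner
import Summits.QuantumFields.YangMills.Theorems.BalabanLadderIRAfOnsetLatticeAF
import Summits.QuantumFields.YangMills.Theses.BalabanLadder
import HarnessLib

/-!
# Crux `IR` (stmt-QuantumFields-19354) — PORT of line `uv-pin` (ideator ym-ir-idea-21 g0, lens `barrier`; filed first on `IRcof` 26930 as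
# `Cruxes/IRcof/Lines/uv_pin.lean` 665eb58187b1): `PX(1∕24) ⇐ (C) ConfinedAtEveryCoupling(1∕12) ∧ (A) AFBelowConfinement(1∕12) ∧ (G) ∧ (CF′)`, then `PX → N → IR`

WHY A PORT AND WHAT IT ADDS.  The `uv-pin` stubs (C) (confinement at EVERY coupling), (A) (UV control ∧ PROMPT CONFINEMENT in floor units — rev 1 label after crit-3's verdict: IR content, necessary for PXcof — giving the pin
POINTWISE in `β ≥ β₀` through the PROVED seam `floorPins_of_af`) and (G) (pointwise in `β ≥ β₀`) are all pointwise in the coupling — so the SAME three stubs produce not only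
the cofinal slot token PXcof(1∕24) of `IRcof` but the tree's NON-cofinal token **PX(θ) = `PinnedExit96.PinnedExitAt θ`** (BY NAME — a tree decl,
`Theorems/BalabanLadderIRPinnedExit96.lean`) of the supplier crux `IR` {PX, N}: `px_of_uvpin` (PROVED).  Only the centre-free residual changes:
(CF′) `PinnedExitCentreFreeAt θ` = PX verbatim on `{G₂, F₄, E₈}` (instead of PXcof there).  Composition BY NAME through the tree:
`PinnedExit96.irsc_of_pinnedExit_le (θ ≤ 1∕24) : PX θ → IRsc` and `ColdPressurePincer.IR_of_cases : IRsc → IRnsc → Theses.BalabanLadder.IR`.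
So the line decides the STRONGER crux at no extra located cost on the class with non-trivial centre — recorded here so that the supplier's ledger
carries it; the mathematics, the barrier placement and the HONEST LABEL are those of `Cruxes/IRcof/Lines/uv-pin.md` (b299f86df7f9).

THE LEVER (one paragraph; full text in the IRcof card).  Barrier-inversion of the floor negatives (p624174 ∕ p630186: «any proof must consume
`LowerBounds`»): consume the floor in EXACTLY ONE implication — (A) ⇒ (X_conf) `FloorPinsConfinementOnset` — and keep confinement (C) and the gap (G)
unit-free and floor-free.  (A) says: at a coupling where some thick `4:1` box is `η`-margin-confined, a unit at least `M` confinement units coarse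
makes the floor functional `Q2` of the bare curvature density `< ε` on every large torus — equivalently `L_conf(β) ≤ M·n_ε⁻(β)` (confinement length
at most `M` floor lengths), uniformly in `β`: PROMPT CONFINEMENT in floor units (IR content; one coupling, no `β`-transport).  Count of record
(crit-3 g3, 17:38:06Z): a SPLIT of line `deconfinement-ruler`'s (CU) node, PASS-WITH-PRICE.  The pincer
(C) ∧ (X_conf) closes by modus ponens at the same coupling; (G) upgrades the pinned confined box to a pinned pure one at `κL'`.

HONEST LABEL.  Nothing here proves the Yang–Mills mass gap (Clay), a lattice gap, confinement at weak coupling, `IR`, `IRcof`, or any slot token;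
`IR` 0∕1, `IRcof` 0∕1; R2c IDEA-BOUND; R4 = `BalabanLadder.UV` only.  The sorried declarations are exactly the five `stub_*`.  The slot of record
of 19354 is the LEAD's (`PICKED.md`); this file registers nothing and touches no slot.
-/

set_option autoImplicit false

noncomputable section

open Filter Topology MeasureTheory
open scoped SchwartzMap
open Literature.MathematicalPhysics.QuantumFieldTheory Literature.MathematicalPhysics.QuantumLattice
open Summit.QuantumFields.YangMills.Cruxes.OSLegsFromFemtoAndGap.DlrCollarTransfer (LowerBounds Q2)
open Summit.QuantumFields.YangMills.Cruxes.IR.ColdPurityBridge (coldDefect)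
open Summit.QuantumFields.YangMills.Cruxes.IR.ColdPressurePincer (IRnsc IR_of_cases)
open Summit.QuantumFields.YangMills.Cruxes.IR.PinnedExit96 (PinnedExitAt irsc_of_pinnedExit_le)
open Summit.QuantumFields.YangMills.Cruxes.IR.TwistCost (half_twist_cost_le_coldDefect)
open Summit.QuantumFields.YangMills.Cruxes.IR.ColdPurityDobrushin (coldExitAt_corner_of_dobrushinTV)
open Summit.QuantumFields.YangMills.Cruxes.IR.AfOnset (exists_beta_forall_abs_Q2_le)

namespace Summit.QuantumFields.YangMills.Cruxes.IR.UvPin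

/-! ## §0 Token = the tree's `PinnedExit96.PinnedExitAt θ` (BY NAME); the ruler and (G) verbatim from line `uv-pin` ∕ `deconfinement-ruler` -/

section Ruler

variable {G : Type} [Group G] [TopologicalSpace G] [IsTopologicalGroup G] [CompactSpace G]
  [MeasurableSpace G] [BorelSpace G] {N : ℕ}

/-- **`η`-margin-confined thick box** — verbatim copy of `DeconfinementRuler.MarginConfinedAt` (line 1, 095381460304; token-identical). -/
def MarginConfinedAt (ρ : G →* Matrix (Fin N) (Fin N) ℂ) (β : ℝ) (L : ℕ) (η : ℝ) : Prop :=
  ∀ z : Fin 4 → G, (∀ μ, z μ ∈ Subgroup.center G) →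
    1 - wilsonFinTorusTwistedPartition ρ β z L L L (L / 4) / wilsonFinTorusPartition ρ β L L L (L / 4) ≤ η

end Ruler

/-- **(G)** — verbatim copy of `DeconfinementRuler.ConfinedToPure` (line 1's located residual; token-identical). -/
def ConfinedToPure (η θ : ℝ) : Prop :=
  ∀ (G : Type) [Group G] [TopologicalSpace G] [IsTopologicalGroup G] [CompactSpace G],
    IsCompactSimpleLieGroup G → SimplyConnectedSpace G → (∃ z : G, z ∈ Subgroup.center G ∧ z ≠ 1) →
    letI : MeasurableSpace G := borel G
    haveI : BorelSpace G := ⟨rfl⟩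
    ∀ r : LatticeRep G, ∃ κ : ℕ, ∃ β₀ : ℝ, 1 ≤ κ ∧ ∀ β : ℝ, β₀ ≤ β → ∀ L : ℕ, 8 ≤ L →
      MarginConfinedAt r.ρ β L η → coldDefect r.ρ β (κ * L) ≤ θ

/-- **(CF′) `PinnedExitCentreFreeAt θ`** — the tree's PX(θ) body VERBATIM, restricted to simply-connected simple `G` with TRIVIAL centre
(`G₂, F₄, E₈`): the honest residual of this port (same wall as the slot's PX on that class; no evasion claimed). -/
def PinnedExitCentreFreeAt (θ : ℝ) : Prop :=
  ∀ (G : Type) [Group G] [TopologicalSpace G] [IsTopologicalGroup G] [CompactSpace G],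
    IsCompactSimpleLieGroup G → SimplyConnectedSpace G → (∀ z : G, z ∈ Subgroup.center G → z = 1) →
    letI : MeasurableSpace G := borel G
    haveI : BorelSpace G := ⟨rfl⟩
    ∀ (r : LatticeRep G) (a : ℝ → ℝ), (∀ β, 0 < a β) → Tendsto a atTop (𝓝 0) → LowerBounds G r a →
      ∃ T β₁ : ℝ, ∀ β : ℝ, β₁ ≤ β → ∃ L : ℕ, 8 ≤ L ∧ a β * (L : ℝ) ≤ T ∧ coldDefect r.ρ β L ≤ θ

/-! ## §1 The statements of this line -/

/-- **(C) `ConfinedAtEveryCoupling η` — CONFINEMENT AT EVERY COUPLING, finite-box twist currency (unit-free, floor-free, rate-free).**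
For simply-connected compact simple `G` with non-trivial centre, every `r` and every `β ≥ 0` there is a thick `4:1` box `L³×⌊L∕4⌋`, `L ≥ 8`, all of
whose central temporal twists cost at most `η·Z`.  Why it might fail: a deconfined (Coulomb-like) window of couplings for some `(G, r)` — none is
expected for any simple `G` (bulk transitions of mixed ∕ large-`N` actions separate two CONFINING regimes), but at weak coupling this is Wilson's
confinement problem and nothing in print proves it in `d = 4`.  PROVED for `0 ≤ β ≤ 1∕(216N)` (`confinedAtEveryCoupling_rung_dobrushin`). -/
def ConfinedAtEveryCoupling (η : ℝ) : Prop :=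
  ∀ (G : Type) [Group G] [TopologicalSpace G] [IsTopologicalGroup G] [CompactSpace G],
    IsCompactSimpleLieGroup G → SimplyConnectedSpace G → (∃ z : G, z ∈ Subgroup.center G ∧ z ≠ 1) →
    letI : MeasurableSpace G := borel G
    haveI : BorelSpace G := ⟨rfl⟩
    ∀ (r : LatticeRep G) (β : ℝ), 0 ≤ β → ∃ L : ℕ, 8 ≤ L ∧ MarginConfinedAt r.ρ β L η

/-- **(X_conf) `FloorPinsConfinementOnset η` — THE PIN, pointwise in the coupling (DERIVED from (A) by `floorPins_of_af`; not a stub).**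
For simply-connected simple `G` with non-trivial centre, every `r`, every positive unit map `a → 0` WITH the floor `LowerBounds G r a`: `∃ T β₀ ∀ β ≥ β₀`,
whenever some thick box is `η`-margin-confined at `β`, one such box `L'` has `a(β)·L' ≤ T`. -/
def FloorPinsConfinementOnset (η : ℝ) : Prop :=
  ∀ (G : Type) [Group G] [TopologicalSpace G] [IsTopologicalGroup G] [CompactSpace G],
    IsCompactSimpleLieGroup G → SimplyConnectedSpace G → (∃ z : G, z ∈ Subgroup.center G ∧ z ≠ 1) →
    letI : MeasurableSpace G := borel G
    haveI : BorelSpace G := ⟨rfl⟩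
    ∀ (r : LatticeRep G) (a : ℝ → ℝ), (∀ β, 0 < a β) → Tendsto a atTop (𝓝 0) → LowerBounds G r a →
      ∃ T β₀ : ℝ, ∀ β : ℝ, β₀ ≤ β → ∀ L : ℕ, 8 ≤ L → MarginConfinedAt r.ρ β L η →
        ∃ L' : ℕ, 8 ≤ L' ∧ MarginConfinedAt r.ρ β L' η ∧ a β * (L' : ℝ) ≤ T

/-- **(A) `AFBelowConfinement η` — rev 1 label (crit-3 g3 verdict 17:38:06Z accepted): UV CONTROL ∧ PROMPT CONFINEMENT IN FLOOR UNITS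
(no unit map, no floor, one coupling at a time; decl name kept from rev 0).**  For simply-connected simple `G` with non-trivial centre, every `r`,
every real test function `v` with positive-time support and every `ε > 0` there are `M, Λ, β₀` with: at every `β ≥ β₀` and every unit `s > 0` such
that SOME thick box is `η`-margin-confined at `β` and EVERY `η`-margin-confined thick box `L'` has `M ≤ s·L'` (the unit is at least `M` confinement
units coarse), the floor functional is small: `Q2 G r β L s (θv) v < ε` for every torus with `Λ ≤ s·L`.
WHAT IT SAYS (the critic's reformulation, adopted): with `n_ε⁻(β)` := the shortest separation scale `1∕s` at which the floor functional reaches `ε`,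
(A) ⇔ `L_conf(β) ≤ M·n_ε⁻(β)` UNIFORMLY in `β ≥ β₀` (plus `Q2 < ε` strictly below `n_ε⁻`).  Asymptotic freedom only says `n_ε⁻` is beyond the
perturbative window; the LOAD of (A) is the UPPER bound on the confinement length in that unit — PROMPT CONFINEMENT (no strongly-correlated but
unconfined range of scales `[n_ε⁻, L_conf∕M]`), i.e. the X-family ∕ confinement-in-units content (census rows 26∕36 re-based at the confinement onset;
row 11 T1), IR and summit-adjacent — NOT Balaban-programme UV content.  It is NECESSARY for PXcof (an admissible unit may sit at the UV end of the
floor, `1∕a(β) ≈ n_ε⁻(β)`; PXcof then wants a pure ⇒ margin-confined box with `L ≤ T·n_ε⁻`), so the stub isolates genuine slot content.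
Why it might fail (live direction): confinement too LATE — a window of scales, growing with `β`, on which plaquette correlations are already strong
(`Q2 ≥ ε`) but no thick box is yet margin-confined (a long crossover); for `SU(N)` none is expected («one scale»: `n_ε⁻ ≍ L_conf ≍ ξ`), but that
expectation IS the open IR content.  (The other direction — confinement while the coupling is still perturbative — is harmless here.)
Tree-adjacent PROVED case: units bounded below (`AfOnset.exists_abs_Q2_le_log_sq`, `exists_beta_forall_abs_Q2_le`); format rung
`afBelowConfinement_rung_bddOnset`. -/
def AFBelowConfinement (η : ℝ) : Prop :=
  ∀ (G : Type) [Group G] [TopologicalSpace G] [IsTopologicalGroup G] [CompactSpace G],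
    IsCompactSimpleLieGroup G → SimplyConnectedSpace G → (∃ z : G, z ∈ Subgroup.center G ∧ z ≠ 1) →
    letI : MeasurableSpace G := borel G
    haveI : BorelSpace G := ⟨rfl⟩
    ∀ (r : LatticeRep G) (v : 𝓢(EuclideanSpace ℝ (Fin 4), ℝ)), tsupport v ⊆ {y : EuclideanSpace ℝ (Fin 4) | 0 < y 0} →
      ∀ ε : ℝ, 0 < ε → ∃ M Λ β₀ : ℝ, ∀ β : ℝ, β₀ ≤ β → ∀ s : ℝ, 0 < s →
        (∃ L₁ : ℕ, 8 ≤ L₁ ∧ MarginConfinedAt r.ρ β L₁ η) →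
        (∀ L' : ℕ, 8 ≤ L' → MarginConfinedAt r.ρ β L' η → M ≤ s * (L' : ℝ)) →
        ∀ L : ℕ, Λ ≤ s * (L : ℝ) → Q2 G r β L s (thetaTest 4 v) v < ε

/-! ## §2 The FIVE stubs (the only sorried declarations): (C), (A), (G), (CF′), N -/

/-- stub (C): confinement at every coupling, margin `1∕12`. -/
theorem stub_confinedAtEveryCoupling : ConfinedAtEveryCoupling (1 / 12) := by
  sorry

/-- stub (A): UV control ∧ PROMPT CONFINEMENT in floor units (`L_conf ≤ M·n_ε⁻`), margin `1∕12` (rev 1 label; IR content, necessary for PXcof). -/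
theorem stub_afBelowConfinement : AFBelowConfinement (1 / 12) := by
  sorry

/-- stub (G): margin-confined at `L` ⇒ `1∕24`-pure at `κL` (line 1's located residual, shared token). -/
theorem stub_confinedToPure : ConfinedToPure (1 / 12) (1 / 24) := by
  sorry

/-- stub (CF′): PX(1∕24) verbatim on the centre-free class (residual of the port). -/
theorem stub_pxCentreFree : PinnedExitCentreFreeAt (1 / 24) := by
  sorry

/-- stub N: the supplier's second token `ColdPressurePincer.IRnsc` BY NAME. -/
theorem stub_irnsc : IRnsc := by
  sorry

/-! ## §3 PROVED SEAMS: (A) ⇒ (X_conf);  (C) ∧ (X_conf) ∧ (G) ∧ (CF′) ⇒ PX (pointwise in β) -/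

/-- **The floor is consumed HERE and only here: `AFBelowConfinement η → FloorPinsConfinementOnset η` (PROVED).**  Take the floor's clause (i)
witnesses `v, ε, β₅, Λ₅`; (A) gives `M, Λ, β₀`; the pin is `T = M` beyond `max β₀ β₅`: if at such a `β` some thick box is margin-confined but none fits
under the pin, (A) at unit `s = a(β)` makes `Q2 < ε` on the torus `L = ⌈max Λ Λ₅ ∕ a(β)⌉₊`, where clause (i) says `ε ≤ Q2`. -/
theorem floorPins_of_af {η : ℝ} (hA : AFBelowConfinement η) : FloorPinsConfinementOnset η := by
  intro G _ _ _ _ hGs hsc hZ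
  letI : MeasurableSpace G := borel G
  haveI : BorelSpace G := ⟨rfl⟩
  intro r a ha ha0 hlb
  obtain ⟨⟨v, ε, β₅, Λ₅, hv, hε, hfloor⟩, -⟩ := hlb
  obtain ⟨M, Λ, β₀, hAF⟩ := hA G hGs hsc hZ r v hv ε hε
  refine ⟨M, max β₀ β₅, fun β hβ L hL hconf => ?_⟩
  by_contra hno
  push Not at hno
  have haβ : 0 < a β := ha β
  set Lbig : ℕ := ⌈max Λ Λ₅ / a β⌉₊ with hLbig
  have hbig : max Λ Λ₅ ≤ a β * (Lbig : ℝ) := by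
    have hceil : max Λ Λ₅ / a β ≤ (Lbig : ℝ) := Nat.le_ceil _
    calc max Λ Λ₅ = a β * (max Λ Λ₅ / a β) := by field_simp
      _ ≤ a β * (Lbig : ℝ) := mul_le_mul_of_nonneg_left hceil haβ.le
  have hQ : Q2 G r β Lbig (a β) (thetaTest 4 v) v < ε :=
    hAF β ((le_max_left _ _).trans hβ) (a β) haβ ⟨L, hL, hconf⟩
      (fun L' hL' hc => (hno L' hL' hc).le) Lbig ((le_max_left _ _).trans hbig)
  have hF : ε ≤ Q2 G r β Lbig (a β) (thetaTest 4 v) v :=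
    hfloor β ((le_max_right _ _).trans hβ) Lbig ((le_max_right _ _).trans hbig)
  exact absurd hF (not_le.mpr hQ)

/-- **`(C)(η) ∧ (X_conf)(η) ∧ (G)(η,θ) ∧ (CF′)(θ) ⇒ PX(θ)` — the tree's NON-cofinal token, PROVED.**  Centre non-trivial: with `T, β₀` from
(X_conf) and `κ, β₀'` from (G), put `β₁ := max (max β₀ β₀') 0`; EVERY `β ≥ β₁` has a margin-confined thick box by (C), one under the pin by (X_conf),
and a `θ`-pure one at `κL'` by (G), pinned by `κT`.  Centre-free: (CF′) verbatim. -/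
theorem px_of_uvpin {η θ : ℝ} (hC : ConfinedAtEveryCoupling η) (hX : FloorPinsConfinementOnset η) (hG : ConfinedToPure η θ)
    (hCF : PinnedExitCentreFreeAt θ) : PinnedExitAt θ := by
  intro G _ _ _ _ hGs hsc
  letI : MeasurableSpace G := borel G
  haveI : BorelSpace G := ⟨rfl⟩
  intro r a ha ha0 hlb
  by_cases hZ : ∃ z : G, z ∈ Subgroup.center G ∧ z ≠ 1
  · obtain ⟨T, β₀, hpin⟩ := hX G hGs hsc hZ r a ha ha0 hlb
    obtain ⟨κ, β₀', hκ, hup⟩ := hG G hGs hsc hZ r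
    refine ⟨(κ : ℝ) * T, max (max β₀ β₀') 0, fun β hβ => ?_⟩
    obtain ⟨L, hL, hconf⟩ := hC G hGs hsc hZ r β ((le_max_right _ _).trans hβ)
    obtain ⟨L', hL', hconf', hpin'⟩ := hpin β (((le_max_left _ _).trans (le_max_left _ _)).trans hβ) L hL hconf
    refine ⟨κ * L', ?_, ?_, hup β (((le_max_right _ _).trans (le_max_left _ _)).trans hβ) L' hL' hconf'⟩
    · calc 8 ≤ L' := hL'
        _ = 1 * L' := (one_mul L').symm
        _ ≤ κ * L' := Nat.mul_le_mul_right L' hκ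
    · have hk : (0 : ℝ) ≤ (κ : ℝ) := Nat.cast_nonneg κ
      calc a β * ((κ * L' : ℕ) : ℝ) = (κ : ℝ) * (a β * (L' : ℝ)) := by push_cast; ring
        _ ≤ (κ : ℝ) * T := mul_le_mul_of_nonneg_left hpin' hk
  · push Not at hZ
    exact hCF G hGs hsc hZ r a ha ha0 hlb

/-! ## §4 PROVED RUNGS (in-regime, hypothesis-using) -/

/-- **(C) in the Dobrushin corner:** for every compact metrisable `G`, every `r`, every `0 ≤ β ≤ 1∕(216N)`, EVERY thick box `L ≥ max L₀ 8` is
`1∕12`-margin-confined — S1 (half the twist cost ≤ the purity defect) + the landed cold-purity corner at `θ = 1∕24`. -/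
theorem confinedAtEveryCoupling_rung_dobrushin :
    ∃ L₀ : ℕ, ∀ (G : Type) [Group G] [TopologicalSpace G] [IsTopologicalGroup G] [CompactSpace G]
      [MeasurableSpace G] [BorelSpace G] (r : LatticeRep G) (β : ℝ), 0 ≤ β → 216 * (r.N : ℝ) * β ≤ 1 →
      ∀ L : ℕ, max L₀ 8 ≤ L → MarginConfinedAt r.ρ β L (1 / 12) := by
  obtain ⟨L₀, hL₀⟩ := coldExitAt_corner_of_dobrushinTV (θ := 1 / 24) (by norm_num)
  refine ⟨L₀, fun G _ _ _ _ _ _ r β h0 hβ L hL z hz => ?_⟩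
  haveI : SecondCountableTopology G :=
    (r.continuous.isClosedEmbedding r.injective).isEmbedding.secondCountableTopology
  have hδ := hL₀ G r β h0 hβ L ((le_max_left _ _).trans hL)
  have h := (half_twist_cost_le_coldDefect r.continuous r.mem_unitary h0 ((le_max_right _ _).trans hL) hz).1
  linarith

/-- **(C)'s conclusion in the corner** (the `∃ L` form of the stub). -/
theorem confinedAt_of_dobrushin :
    ∀ (G : Type) [Group G] [TopologicalSpace G] [IsTopologicalGroup G] [CompactSpace G]
      [MeasurableSpace G] [BorelSpace G] (r : LatticeRep G) (β : ℝ), 0 ≤ β → 216 * (r.N : ℝ) * β ≤ 1 →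
      ∃ L : ℕ, 8 ≤ L ∧ MarginConfinedAt r.ρ β L (1 / 12) := by
  obtain ⟨L₀, h⟩ := confinedAtEveryCoupling_rung_dobrushin
  exact fun G _ _ _ _ _ _ r β h0 hβ => ⟨max L₀ 8, le_max_right _ _, h G r β h0 hβ _ le_rfl⟩

/-- **(A) at BOUNDED confinement onset (format rung from the tree's lattice-AF theorem):** if the margin-confined box witnessing the hypothesis has
`L₁ ≤ Lmax`, then «every confined box is `≥ M = Lmax` units» forces `s ≥ 1`, and `AfOnset.exists_beta_forall_abs_Q2_le` (units bounded below ⇒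
`|Q2| ≤ ε∕2` for `β ≥ β₁`, uniformly in the torus) gives `Q2 < ε`.  The open content of (A) is the complementary regime `L_conf(β) → ∞`. -/
theorem afBelowConfinement_rung_bddOnset (Lmax : ℕ) (η : ℝ) :
    ∀ (G : Type) [Group G] [TopologicalSpace G] [IsTopologicalGroup G] [CompactSpace G]
      [MeasurableSpace G] [BorelSpace G] (r : LatticeRep G) (v : 𝓢(EuclideanSpace ℝ (Fin 4), ℝ)),
      ∀ ε : ℝ, 0 < ε → ∃ M Λ β₀ : ℝ, ∀ β : ℝ, β₀ ≤ β → ∀ s : ℝ, 0 < s →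
        (∃ L₁ : ℕ, 8 ≤ L₁ ∧ L₁ ≤ Lmax ∧ MarginConfinedAt r.ρ β L₁ η) →
        (∀ L' : ℕ, 8 ≤ L' → MarginConfinedAt r.ρ β L' η → M ≤ s * (L' : ℝ)) →
        ∀ L : ℕ, Λ ≤ s * (L : ℝ) → Q2 G r β L s (thetaTest 4 v) v < ε := by
  intro G _ _ _ _ _ _ r v ε hε
  obtain ⟨β₁, -, hβ₁⟩ := exists_beta_forall_abs_Q2_le r (thetaTest 4 v) v one_pos (half_pos hε)
  refine ⟨(Lmax : ℝ), 1, β₁, fun β hβ s hs hL₁ hall L hL => ?_⟩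
  obtain ⟨L₁, h8, hLm, hconf⟩ := hL₁
  have hM : (Lmax : ℝ) ≤ s * (L₁ : ℝ) := hall L₁ h8 hconf
  have hL₁pos : (0 : ℝ) < (L₁ : ℝ) := by exact_mod_cast (show 0 < L₁ by omega)
  have hs1 : 1 ≤ s := by
    have hLm' : (L₁ : ℝ) ≤ (Lmax : ℝ) := by exact_mod_cast hLm
    nlinarith
  have hLpos : 1 ≤ L := by
    rcases Nat.eq_zero_or_pos L with h | h
    · subst h; simp at hL; linarith
    · exact h
  have hq := hβ₁ β hβ L hLpos s hs1
  have := (abs_le.mp hq).2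
  linarith

/-! ## §5 Composition onto the supplier's bill {PX, N}: the route decl `Theses.BalabanLadder.IR` BY NAME -/

/-- The bill of this port: `(C) → (A) → (G) → (CF′) → N → IR`. -/
def Bill : Prop :=
  ConfinedAtEveryCoupling (1 / 12) → AFBelowConfinement (1 / 12) → ConfinedToPure (1 / 12) (1 / 24) →
    PinnedExitCentreFreeAt (1 / 24) → IRnsc → Summit.QuantumFields.YangMills.Theses.BalabanLadder.IR

/-- **The composition (PROVED, no sorry):** (A) ⇒ (X_conf) [`floorPins_of_af`]; (C) ∧ (X_conf) ∧ (G) ∧ (CF′) ⇒ PX(1∕24) [`px_of_uvpin`];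
PX(1∕24) ⇒ IRsc [tree: `PinnedExit96.irsc_of_pinnedExit_le`]; IRsc ∧ IRnsc ⇒ IR [tree: `ColdPressurePincer.IR_of_cases`]. -/
theorem IR_of : Bill := by
  intro hC hA hG hCF hN
  exact IR_of_cases (irsc_of_pinnedExit_le (by norm_num) (px_of_uvpin hC (floorPins_of_af hA) hG hCF)) hN

/-- **The route decl BY NAME from the five stubs** (kernel-checked modulo exactly the stubs). -/
theorem IR_of_stubs : Summit.QuantumFields.YangMills.Theses.BalabanLadder.IR :=
  IR_of stub_confinedAtEveryCoupling stub_afBelowConfinement stub_confinedToPure stub_pxCentreFree stub_irnsc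

/-- The supplier token PX(1∕24) (tree decl `PinnedExit96.PinnedExitAt (1/24)`) from the stubs. -/
theorem px24_of_stubs : PinnedExitAt (1 / 24) :=
  px_of_uvpin stub_confinedAtEveryCoupling (floorPins_of_af stub_afBelowConfinement) stub_confinedToPure stub_pxCentreFree

end Summit.QuantumFields.YangMills.Cruxes.IR.UvPin

end
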